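import Literature.Analysis.FluidPDE.TypeIAncientMild
import Literature.Analysis.FluidPDE.LerayGaugeStrainSpectrum
import Literature.Analysis.FluidPDE.DeviatoricHessian
import Literature.Analysis.FluidPDE.ClassicalSolution
import Literature.Analysis.FluidPDE.PressurePoisson
import Literature.Analysis.FluidPDE.VorticityStretching
import Literature.Analysis.FluidPDE.EnstrophySplitting
import Literature.Analysis.FluidPDE.TsaiMaximumPrinciple
import Summits.NavierStokesRegularity.NavierStokesRegularity.Theorems.SqueezeCycleStrainAlgebra
import HarnessLib

/-!
# Route `SqueezeCycle`, crux `ExtremalBiaxialitySubcritical` — the stretch-record budget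
# (line `oseen-shell-polar-tomography`, stub `stub_stretchRecordBudget`)

Helper file for item `stmt-NavierStokesRegularity-11609`
(`Summit.NavierStokesRegularity.NavierStokesRegularity.Theses.SqueezeCycle.ExtremalBiaxialitySubcritical`).

Main result `stub_stretchRecordBudget`: for a Type-I KNSS-mild ancient field `u` with a classical
pressure `p` on a window `(t', 0) ∋ t₁`, a fixed unit vector `e`, a space-time maximum `(t₁, x₁)`
(value `M`) of the gauge stretching `(−t)⟪∇u(t,x) e, e⟫` at which `e` is also Rayleigh-maximal
for `∇u(t₁,x₁)`, and `Λ_u(t₁,x₁) ≤ m`: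
`⅓M² + M(1 − ⅔m) − ⅔m² ≤ −(−t₁)²⟪H e, e⟫ + ((−t₁)²|ω|² − ((−t₁)ω·e)²)/12 − ((−t₁)ω·e)²/6`,
`H = deviatoricHessian (p t₁) x₁`, `ω = curl (u t₁) x₁`.

* `budget_core` (calculus): with `A = ∇u(t₁,x₁)`, `a = ⟪∇u e, e⟫`: `(−t₁)∂ₜa = a`, `∇a = 0`,
  `Δa ≤ 0` at the record; the `e`-derivative of the momentum equation (`∂ₜ∇u = ∇∂ₜu`,
  `∂ₑΔ = Δ∂ₑ`, `D((u·∇)u) = A² + D²u(·,u)`) gives `∂ₜa ≤ −⟪A²e,e⟫ − ⟪He,e⟫ − Δp/3`,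
  `Δp = −tr A²`.
* linear algebra: `(A + Aᵀ)e = 2λe` at the Rayleigh maximiser
  (`inner_add_inner_eq_of_rayleigh_max`), so `⟪A²e,e⟫ = 2λ² − ‖Ae‖²` and
  `|ω|² − (ω·e)² = 4‖Ae‖² − 4λ²` (`norm_vort_sq_sub_eq`); `tr A² = λ₁² + λ₂² + (λ₁+λ₂)² − ½|ω|²`,
  `λ₁ ≤ λ`, `(−t₁)λ₂ = Λ ≤ m` (`strain_spectrum_package`); then `(M − L₁)(M + L₁ + Λ) ≥ 0`,
  `(m − Λ)(m + Λ + M) ≥ 0` with `Lᵢ = (−t₁)λᵢ`, `(−t₁)λ = M`.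
Source of the velocity-gradient equation `DV/Dt + V² = −P + νΔV`, `Δp = −tr V²`: Majda–Bertozzi,
*Vorticity and Incompressible Flow*, CUP 2002, (1.29), (1.84). Everything here is proved.
-/

noncomputable section

open Set Filter Topology InnerProductSpace
open scoped RealInnerProductSpace Matrix Laplacian ContDiff

set_option linter.dupNamespace false

namespace Summit.NavierStokesRegularity.NavierStokesRegularity.Theorems

open Literature.Analysis.FluidPDE

/-! ## Linear algebra at a Rayleigh maximiser -/

/-- **First variation at a maximiser of the Rayleigh quotient**: if `⟪Ax, x⟫ ≤ λ‖x‖²` for all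
`x` with equality at `e`, then `⟪Ae, z⟫ + ⟪Az, e⟫ = 2λ⟪e, z⟫` for every `z`, i.e.
`(A + Aᵀ)e = 2λe` (expand `λ‖e + sz‖² − ⟪A(e + sz), e + sz⟫ ≥ 0` to first order in `s`).
[folklore] -/
theorem inner_add_inner_eq_of_rayleigh_max {V : Type*} [NormedAddCommGroup V]
    [InnerProductSpace ℝ V] (A : V →L[ℝ] V) {l : ℝ} {e : V}
    (h1 : ∀ x, ⟪A x, x⟫ ≤ l * ‖x‖ ^ 2) (h2 : ⟪A e, e⟫ = l * ‖e‖ ^ 2) (z : V) :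
    ⟪A e, z⟫ + ⟪A z, e⟫ = 2 * l * ⟪e, z⟫ := by
  set β : ℝ := 2 * l * ⟪e, z⟫ - (⟪A e, z⟫ + ⟪A z, e⟫) with hβ
  set γ : ℝ := l * ‖z‖ ^ 2 - ⟪A z, z⟫ with hγ
  have key : ∀ s : ℝ, 0 ≤ s * β + s ^ 2 * γ := fun s => by
    have h := sub_nonneg.2 (h1 (e + s • z))
    have hexp : l * ‖e + s • z‖ ^ 2 - ⟪A (e + s • z), e + s • z⟫ = s * β + s ^ 2 * γ := by
      rw [norm_add_sq_real, map_add, map_smul, norm_smul, mul_pow, Real.norm_eq_abs, sq_abs,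
        real_inner_smul_right]
      simp only [inner_add_left, inner_add_right, real_inner_smul_left, real_inner_smul_right]
      rw [h2, hβ, hγ]
      ring
    rwa [hexp] at h
  have hk := key (-β / (γ + 1))
  have hγ1 : 0 < γ + 1 := by linarith [sub_nonneg.2 (h1 z)]
  have hval : -β / (γ + 1) * β + (-β / (γ + 1)) ^ 2 * γ = -(β ^ 2 / (γ + 1) ^ 2) := by
    field_simp
    ring
  rw [hval] at hk
  have h3 : β ^ 2 / (γ + 1) ^ 2 = 0 :=
    le_antisymm (by linarith) (div_nonneg (sq_nonneg β) (sq_nonneg _))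
  have hβ0 : β = 0 := by simpa [hγ1.ne'] using h3
  linarith

/-- **Vorticity at a Rayleigh maximiser**: for `A : ℝ³ → ℝ³` linear with `(A + Aᵀ)e = 2λe`
(as `⟪Ae, z⟫ + ⟪Az, e⟫ = 2λ⟪e, z⟫`), `‖e‖ = 1`, `⟪Ae, e⟫ = λ`, and `ω` the axial vector of `A − Aᵀ`
(the componentwise `curl`): `|ω|² − ⟪ω, e⟫² = 4‖Ae‖² − 4λ²` — Lagrange's identity
`|ω × e|² = |ω|²|e|² − (ω·e)²` with `ω × e = (A − Aᵀ)e = 2Ae − 2λe`, in coordinates. [folklore] -/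
theorem norm_vort_sq_sub_eq (A : EuclideanSpace ℝ (Fin 3) →L[ℝ] EuclideanSpace ℝ (Fin 3)) {l : ℝ}
    {e : EuclideanSpace ℝ (Fin 3)}
    (hc : ∀ z, ⟪A e, z⟫ + ⟪A z, e⟫ = 2 * l * ⟪e, z⟫) (he : ‖e‖ = 1) (hl : ⟪A e, e⟫ = l) :
    ‖curlCLM A‖ ^ 2 - ⟪curlCLM A, e⟫ ^ 2 = 4 * ‖A e‖ ^ 2 - 4 * l ^ 2 := by
  have key : ∀ n00 n01 n02 n10 n11 n12 n20 n21 n22 e0 e1 e2 : ℝ,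
      (e0 * n00 + e1 * n01 + e2 * n02) + (n00 * e0 + n10 * e1 + n20 * e2) = 2 * l * e0 →
      (e0 * n10 + e1 * n11 + e2 * n12) + (n01 * e0 + n11 * e1 + n21 * e2) = 2 * l * e1 →
      (e0 * n20 + e1 * n21 + e2 * n22) + (n02 * e0 + n12 * e1 + n22 * e2) = 2 * l * e2 →
      (e0 * n00 + e1 * n01 + e2 * n02) * e0 + (e0 * n10 + e1 * n11 + e2 * n12) * e1 +
        (e0 * n20 + e1 * n21 + e2 * n22) * e2 = l → e0 ^ 2 + e1 ^ 2 + e2 ^ 2 = 1 →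
      (n21 - n12) ^ 2 + (n02 - n20) ^ 2 + (n10 - n01) ^ 2 -
          ((n21 - n12) * e0 + (n02 - n20) * e1 + (n10 - n01) * e2) ^ 2 =
        4 * ((e0 * n00 + e1 * n01 + e2 * n02) ^ 2 + (e0 * n10 + e1 * n11 + e2 * n12) ^ 2 +
          (e0 * n20 + e1 * n21 + e2 * n22) ^ 2) - 4 * l ^ 2 := by
    intro n00 n01 n02 n10 n11 n12 n20 n21 n22 e0 e1 e2 hc0 hc1 hc2 hP hE
    linear_combination (-8 * l) * hP +
      (4 * l ^ 2 - ((n21 - n12) ^ 2 + (n02 - n20) ^ 2 + (n10 - n01) ^ 2)) * hE -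
      (4 * (e0 * n00 + e1 * n01 + e2 * n02) - 4 * l * e0 -
        ((e0 * n00 + e1 * n01 + e2 * n02) + (n00 * e0 + n10 * e1 + n20 * e2) - 2 * l * e0)) * hc0 -
      (4 * (e0 * n10 + e1 * n11 + e2 * n12) - 4 * l * e1 -
        ((e0 * n10 + e1 * n11 + e2 * n12) + (n01 * e0 + n11 * e1 + n21 * e2) - 2 * l * e1)) * hc1 -
      (4 * (e0 * n20 + e1 * n21 + e2 * n22) - 4 * l * e2 -
        ((e0 * n20 + e1 * n21 + e2 * n22) + (n02 * e0 + n12 * e1 + n22 * e2) - 2 * l * e2)) * hc2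
  have hin : ∀ x y : EuclideanSpace ℝ (Fin 3), ⟪x, y⟫ = x 0 * y 0 + x 1 * y 1 + x 2 * y 2 :=
    fun x y => by
    simp only [PiLp.inner_apply, RCLike.inner_apply, conj_trivial, Fin.sum_univ_three]
    ring
  have hnsq : ∀ x : EuclideanSpace ℝ (Fin 3), ‖x‖ ^ 2 = x 0 ^ 2 + x 1 ^ 2 + x 2 ^ 2 := fun x => by
    rw [EuclideanSpace.real_norm_sq_eq, Fin.sum_univ_three]
  set N := stdMatrix A.toLinearMap with hN
  have hN' : ∀ i j, A (EuclideanSpace.single j 1) i = N i j := fun i j => by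
    rw [hN, stdMatrix_apply, ContinuousLinearMap.coe_coe]
  have hAe : ∀ i, A e i = e 0 * N i 0 + e 1 * N i 1 + e 2 * N i 2 := fun i => by
    rw [clm_apply_coord, Fin.sum_univ_three, hN', hN', hN']
  have hE : e 0 ^ 2 + e 1 ^ 2 + e 2 ^ 2 = 1 := by rw [← hnsq, he, one_pow]
  have hc0 := hc (EuclideanSpace.single 0 1)
  have hc1 := hc (EuclideanSpace.single 1 1)
  have hc2 := hc (EuclideanSpace.single 2 1)
  have hP := hl
  simp only [hin, hAe, PiLp.single_apply, hN'] at hc0 hc1 hc2 hP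
  rw [curlCLM_apply, hnsq, hnsq, hin]
  simp only [hAe, hN', Matrix.cons_val_zero, Matrix.cons_val_one, Matrix.cons_val_two,
    Matrix.head_cons, Matrix.tail_cons]
  linear_combination key (N 0 0) (N 0 1) (N 0 2) (N 1 0) (N 1 1) (N 1 2) (N 2 0) (N 2 1) (N 2 2)
    (e 0) (e 1) (e 2)
    (by simpa using hc0) (by simpa using hc1) (by simpa using hc2) (by linear_combination hP) hE

/-- **The strain spectrum package of a trace-free `A : ℝ³ → ℝ³`.** With `λ₀ ≥ λ₁ ≥ λ₂` the
principal strains (`strainEigenvalues`; `λ₂ = −λ₀ − λ₁` by `tr A = 0`) and `ω` the axial vector of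
`A − Aᵀ`: `λ₁ ≤ λ₀`, `λ₂ ≤ λ₁`, `tr (A ∘ A) = λ₀² + λ₁² + (λ₀ + λ₁)² − ½|ω|²` (`= |S|² − ½|ω|²`;
through `|A + Aᵀ|²_F = ∑ μₖ²`, `sum_sq_entries_eq_sum_eigenvalues_sq`, and a coordinate identity),
and `λ₀ ≤ λ` whenever `⟪Ax, x⟫ ≤ λ‖x‖²` for all `x` (evaluate at the top eigenvector). [folklore] -/
theorem strain_spectrum_package (A : EuclideanSpace ℝ (Fin 3) →L[ℝ] EuclideanSpace ℝ (Fin 3))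
    (htr : LinearMap.trace ℝ _ A.toLinearMap = 0) :
    ∃ s0 s1 : ℝ, s1 = strainEigenvalues A.toLinearMap finrank_euclideanSpace_fin 1 ∧
      s1 ≤ s0 ∧ -s0 - s1 ≤ s1 ∧
      LinearMap.trace ℝ _ (A.comp A).toLinearMap =
        (s0 ^ 2 + s1 ^ 2 + (s0 + s1) ^ 2) - 2⁻¹ * ‖curlCLM A‖ ^ 2 ∧
      ∀ l : ℝ, (∀ x, ⟪A x, x⟫ ≤ l * ‖x‖ ^ 2) → s0 ≤ l := by
  set N := stdMatrix A.toLinearMap with hN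
  set hM := Matrix.isHermitian_add_transpose_self N
  set eqv : Fin (Fintype.card (Fin 3)) ≃ Fin 3 := Fintype.equivOfCardEq (Fintype.card_fin _)
  have key : ∀ j, hM.eigenvalues (eqv j) = hM.eigenvalues₀ j := fun j => by
    simp [Matrix.IsHermitian.eigenvalues, eqv]
  have hHT : N + Nᴴ = N + Nᵀ := by rw [Matrix.conjTranspose_eq_transpose_of_trivial]
  have htr' : (N + Nᵀ).trace = ∑ j, hM.eigenvalues₀ j := by
    rw [← hHT, hM.trace_eq_sum_eigenvalues, ← eqv.sum_comp]
    simp only [RCLike.ofReal_real_eq_id, id_eq, key]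
  have hfrob : ∑ i, ∑ j, (N + Nᵀ) i j ^ 2 = ∑ k, hM.eigenvalues₀ k ^ 2 := by
    have hent : ∑ i, ∑ j, (N + Nᵀ) i j ^ 2 = ∑ i, ∑ j, (N + Nᴴ) i j ^ 2 := by rw [hHT]
    rw [hent, sum_sq_entries_eq_sum_eigenvalues_sq hM, ← eqv.sum_comp]
    simp only [key]
  have htr0 : (N + Nᵀ).trace = 0 := by
    rw [Matrix.trace_add, Matrix.trace_transpose, hN, trace_stdMatrix, htr, add_zero]
  obtain ⟨-, hs, hs2, h10, h21⟩ :=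
    antitone_fin_three_bookkeeping' (Fintype.card_fin 3) hM.eigenvalues₀ hM.eigenvalues₀_antitone
  set μ := hM.eigenvalues₀
  have hsum : μ 0 + μ 1 + μ 2 = 0 := by rw [← hs, ← htr', htr0]
  have hc1 : Fin.cast (Fintype.card_fin 3).symm (1 : Fin 3) = 1 := Fin.ext (by simp)
  have hl0 : strainEigenvalues A.toLinearMap finrank_euclideanSpace_fin 0 = 2⁻¹ * μ 0 := by
    rw [strainEigenvalues_eq_eigenvalues₀, show Fin.cast _ (0 : Fin 3) = 0 from Fin.ext (by simp)]
  have hN' : ∀ i j, A (EuclideanSpace.single j 1) i = N i j := fun i j => by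
    rw [hN, stdMatrix_apply, ContinuousLinearMap.coe_coe]
  have htrAA : LinearMap.trace ℝ _ (A.comp A).toLinearMap = ∑ m, ∑ k, N k m * N m k := by
    rw [trace_eq_sum_coord]
    refine Finset.sum_congr rfl fun m _ => ?_
    rw [ContinuousLinearMap.comp_apply, clm_apply_coord]
    simp only [hN']
  have hfrob' : ∑ i, ∑ j, (N + Nᵀ) i j ^ 2 = ∑ i, ∑ j, (N i j + N j i) ^ 2 := by
    simp only [Matrix.add_apply, Matrix.transpose_apply]
  have hnorm :
      ‖curlCLM A‖ ^ 2 = (N 2 1 - N 1 2) ^ 2 + (N 0 2 - N 2 0) ^ 2 + (N 1 0 - N 0 1) ^ 2 := by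
    rw [curlCLM_apply, EuclideanSpace.real_norm_sq_eq, Fin.sum_univ_three]
    simp [hN']
  refine ⟨2⁻¹ * μ 0, 2⁻¹ * μ 1, by rw [strainEigenvalues_eq_eigenvalues₀, hc1], by linarith,
    by linarith, ?_, fun l h1 => ?_⟩
  · rw [hs2, hfrob', show μ 2 = -μ 0 - μ 1 by linarith] at hfrob
    simp only [Fin.sum_univ_three] at hfrob
    rw [htrAA, hnorm]
    simp only [Fin.sum_univ_three]
    linear_combination (1 / 4 : ℝ) * hfrob
  · -- the top principal strain is dominated by the Rayleigh bound: evaluate at the eigenvector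
    have hT := isSymmetric_addAdjoint A.toLinearMap
    set b := hT.eigenvectorBasis finrank_euclideanSpace_fin with hb_def
    have hb : ‖b 0‖ = 1 := b.orthonormal.1 0
    have hq : ⟪addAdjoint A.toLinearMap (b 0), b 0⟫ =
        hT.eigenvalues finrank_euclideanSpace_fin 0 := by
      rw [hT.apply_eigenvectorBasis _ 0, real_inner_smul_left, real_inner_self_eq_norm_sq, hb]
      simp
    rw [← hl0, strainEigenvalues_def, ← hq, inner_addAdjoint_apply_self]
    have := h1 (b 0)
    rw [hb] at this
    rw [ContinuousLinearMap.coe_coe]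
    linarith

/-! ## Calculus at a space-time stretching record -/

/-- **The `ee`-component of the strain equation at a space-time record, with the maximum
principle.** Let `(u, p)` be a classical Navier–Stokes solution (`ν = 1`, no force) on an open time
set `S₀ ∋ t₁`, `t₁ ≤ 0`, `e` a unit vector, and let `s ↦ (−s)⟪∇u(s,x₁)e, e⟫` have a local maximum
at `t₁` and `y ↦ ⟪∇u(t₁,y)e, e⟫` one at `x₁`. With `A = ∇u(t₁,x₁)`,
`H = deviatoricHessian (p t₁) x₁`:
`⟪Ae, e⟫ ≤ (−t₁)(−⟪He, e⟫ + tr(A ∘ A)/3 − ⟪A(Ae), e⟫)`. Differentiate the momentum equation along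
`e` (`∂ₜ∇u = ∇∂ₜu`, `∂ₑΔu = Δ∂ₑu`, `D((u·∇)u) = A ∘ A + D²u(·, u)`), use `(−t₁)∂ₜa = a`, `∇a = 0`,
`Δa ≤ 0` at the record, `∂ₑ∂ₑp = ⟪He,e⟫ + Δp/3` and `Δp = −div((u·∇)u) = −tr(A ∘ A)` (`div u = 0`):
the velocity-gradient equation `DV/Dt + V² = −P + ΔV` (Majda–Bertozzi 2002, (1.29), (1.84)).
[cite: MajdaBertozziCUP2002, §1.4 proof of Prop. 1.5 eq. (1.29) and §1.8 eq. (1.84)] -/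
theorem budget_core {S₀ : Set ℝ} (hS : IsOpen S₀) {p : ℝ → EuclideanSpace ℝ (Fin 3) → ℝ}
    {u : ℝ → EuclideanSpace ℝ (Fin 3) → EuclideanSpace ℝ (Fin 3)}
    (hcl : IsClassicalNSSolutionOn S₀ 1 0 u p) {t₁ : ℝ} (ht₁S : t₁ ∈ S₀) (ht : 0 ≤ -t₁)
    {x₁ e : EuclideanSpace ℝ (Fin 3)} (he : ‖e‖ = 1)
    (hmax_t : IsLocalMax (fun s => (-s) * ⟪fderiv ℝ (u s) x₁ e, e⟫) t₁)
    (hmax_x : IsLocalMax (fun y => ⟪fderiv ℝ (u t₁) y e, e⟫) x₁) :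
    ⟪fderiv ℝ (u t₁) x₁ e, e⟫ ≤ (-t₁) * (-⟪deviatoricHessian (p t₁) x₁ e, e⟫ +
      LinearMap.trace ℝ _ ((fderiv ℝ (u t₁) x₁).comp (fderiv ℝ (u t₁) x₁)).toLinearMap / 3 -
      ⟪fderiv ℝ (u t₁) x₁ (fderiv ℝ (u t₁) x₁ e), e⟫) := by
  set U := u t₁ with hU
  set P := p t₁ with hP
  set A := fderiv ℝ U x₁ with hA
  have hUs : ContDiff ℝ ∞ U := hcl.contDiff_velocity ht₁S
  have hU3 : ContDiff ℝ 3 U := hUs.of_le (by norm_cast)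
  have hU2 : ContDiff ℝ 2 U := hUs.of_le (by norm_cast)
  have hP2 : ContDiff ℝ 2 P := (hcl.contDiff_pressure ht₁S).of_le (by norm_cast)
  have hUd : Differentiable ℝ U := hU2.differentiable (by norm_num)
  have hDUd : Differentiable ℝ (fderiv ℝ U) :=
    (hU2.fderiv_right (m := 1) le_rfl).differentiable one_ne_zero
  have hDe2 : ContDiff ℝ 2 (fun y => fderiv ℝ U y e) :=
    (hU3.fderiv_right (m := 2) (by norm_cast)).clm_apply contDiff_const
  have hdivU : ∀ y, VectorCalculus.divergence U y = 0 := hcl.divFree t₁ ht₁S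
  have hsymm : IsSymmSndFDerivAt ℝ U x₁ := hU2.contDiffAt.isSymmSndFDerivAt (by simp)
  -- the time derivative `w = ∂ₜu(t₁, ·)`; the momentum equation solved for it; `Dw(x₁) e`
  set w : EuclideanSpace ℝ (Fin 3) → EuclideanSpace ℝ (Fin 3) := fun y => deriv (fun s => u s y) t₁
    with hw
  have hEq : w = fun y => (Δ U) y - gradient P y - convect U U y := by
    funext y
    have hm := hcl.momentum t₁ ht₁S y
    rw [timeDerivWithin_eq_deriv hS ht₁S, one_smul, Pi.zero_apply, Pi.zero_apply, add_zero] at hm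
    exact eq_sub_of_add_eq hm
  have hΔd : DifferentiableAt ℝ (Δ U) x₁ := differentiable_laplacian hU3 x₁
  have hgd : DifferentiableAt ℝ (gradient P) x₁ :=
    ((InnerProductSpace.toDual ℝ (EuclideanSpace ℝ (Fin 3))).symm.contDiff.comp
      (hP2.fderiv_right (m := 1) le_rfl) |>.differentiable one_ne_zero) x₁
  have hconv : HasFDerivAt (convect U U)
      (A.comp A + (fderiv ℝ (fderiv ℝ U) x₁).flip (U x₁)) x₁ :=
    (hDUd x₁).hasFDerivAt.clm_apply (hUd x₁).hasFDerivAt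
  have hwD : HasFDerivAt w (fderiv ℝ (Δ U) x₁ - fderiv ℝ (gradient P) x₁ -
      (A.comp A + (fderiv ℝ (fderiv ℝ U) x₁).flip (U x₁))) x₁ := by
    rw [hEq]
    exact (hΔd.hasFDerivAt.sub hgd.hasFDerivAt).sub hconv
  have hDw : fderiv ℝ w x₁ e = fderiv ℝ (Δ U) x₁ e - fderiv ℝ (gradient P) x₁ e -
      (A (A e) + fderiv ℝ (fderiv ℝ U) x₁ e (U x₁)) := by
    rw [hwD.fderiv]
    rfl
  -- first-order condition in time: `(-t₁) ∂ₜ a = a` (`∂ₜ ∇u = ∇ ∂ₜu`)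
  have hder : HasDerivAt (fun s => fderiv ℝ (u s) x₁ e) (fderiv ℝ w x₁ e) t₁ :=
    hcl.smooth_velocity.hasDerivAt_fderiv_slice hS ht₁S x₁ e
  have hder2 : HasDerivAt (fun s => ⟪fderiv ℝ (u s) x₁ e, e⟫) ⟪fderiv ℝ w x₁ e, e⟫ t₁ := by
    simpa using hder.inner ℝ (hasDerivAt_const t₁ e)
  have hE2 := hmax_t.hasDerivAt_eq_zero (((hasDerivAt_id' t₁).neg).mul hder2)
  have hE2' : -1 * ⟪A e, e⟫ + (-t₁) * ⟪fderiv ℝ w x₁ e, e⟫ = 0 := hE2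
  -- first/second-order conditions in space: `∇a = 0`, `Δa ≤ 0`
  set a : EuclideanSpace ℝ (Fin 3) → ℝ := fun y => ⟪fderiv ℝ U y e, e⟫ with ha
  have ha2 : ContDiff ℝ 2 a := hDe2.inner ℝ contDiff_const
  have hT4 : ⟪fderiv ℝ (fderiv ℝ U) x₁ e (U x₁), e⟫ = 0 := by
    have hda : fderiv ℝ a x₁ (U x₁) = ⟪fderiv ℝ (fderiv ℝ U) x₁ (U x₁) e, e⟫ := by
      rw [ha, fderiv_inner_apply ℝ (hDe2.differentiable two_ne_zero x₁) (differentiableAt_const e),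
        fderiv_apply_const_apply (hDUd x₁)]
      simp
    rw [hsymm e (U x₁), ← hda, hmax_x.fderiv_eq_zero]
    rfl
  have hT1 : ⟪fderiv ℝ (Δ U) x₁ e, e⟫ ≤ 0 := by
    have hlap : ⟪fderiv ℝ (Δ U) x₁ e, e⟫ = (Δ a) x₁ := by
      rw [fderiv_laplacian_apply_of_contDiff_three hU3 x₁ e]
      have ha' : a = (innerSL ℝ e : EuclideanSpace ℝ (Fin 3) →L[ℝ] ℝ) ∘ (fun y => fderiv ℝ U y e) :=
        by
        funext y
        simp [ha, real_inner_comm]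
      rw [ha', hDe2.contDiffAt.laplacian_CLM_comp_left]
      simp [real_inner_comm]
    rw [hlap]
    exact laplacian_nonpos_of_isLocalMax ha2 hmax_x
  -- the pressure term: deviatoric part plus `Δp/3`, and `Δp = -tr (∇u)²`
  have hT2 : ⟪fderiv ℝ (gradient P) x₁ e, e⟫ = ⟪deviatoricHessian P x₁ e, e⟫ + (Δ P) x₁ / 3 := by
    have h := deviatoricHessian_apply P x₁ e
    rw [finrank_euclideanSpace_fin, eq_sub_iff_add_eq] at h
    rw [← h, inner_add_left, real_inner_smul_left, real_inner_self_eq_norm_sq, he]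
    ring
  have hΔP : (Δ P) x₁ = -LinearMap.trace ℝ _ (A.comp A).toLinearMap := by
    have h := laplacian_pressure_eq_of_isClassicalNSSolutionOn hcl
      (show t₁ ∈ interior S₀ by rwa [hS.interior_eq]) x₁
    have h0 : VectorCalculus.divergence
        ((0 : ℝ → EuclideanSpace ℝ (Fin 3) → EuclideanSpace ℝ (Fin 3)) t₁) x₁ = 0 := by
      simp [VectorCalculus.divergence]
    rw [h0, add_zero] at h
    rw [h, VectorCalculus.divergence, hconv.fderiv, ContinuousLinearMap.toLinearMap_add, map_add]
    set b := stdOrthonormalBasis ℝ (EuclideanSpace ℝ (Fin 3))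
    have hdiv1 : (fun y => ∑ j, ⟪b j, fderiv ℝ U y (b j)⟫) = fun _ => (0 : ℝ) := by
      funext y
      rw [← divergence_eq_sum_inner_fderiv b U y]
      exact hdivU y
    have hflip : LinearMap.trace ℝ _ ((fderiv ℝ (fderiv ℝ U) x₁).flip (U x₁)).toLinearMap = 0 := by
      rw [LinearMap.trace_eq_sum_inner _ b]
      calc ∑ i, ⟪b i, ((fderiv ℝ (fderiv ℝ U) x₁).flip (U x₁)).toLinearMap (b i)⟫
          = ∑ i, ⟪b i, fderiv ℝ (fderiv ℝ U) x₁ (U x₁) (b i)⟫ :=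
            Finset.sum_congr rfl fun i _ => by
              rw [ContinuousLinearMap.coe_coe, ContinuousLinearMap.flip_apply, hsymm (b i) (U x₁)]
        _ = fderiv ℝ (fun y => ∑ j, ⟪b j, fderiv ℝ U y (b j)⟫) x₁ (U x₁) :=
            (fderiv_sum_inner_apply_apply b (hDUd x₁) (U x₁)).symm
        _ = 0 := by rw [hdiv1]; simp
    rw [hflip, add_zero]
  have hDw' : ⟪fderiv ℝ w x₁ e, e⟫ ≤ -⟪deviatoricHessian P x₁ e, e⟫ +
      LinearMap.trace ℝ _ (A.comp A).toLinearMap / 3 - ⟪A (A e), e⟫ := by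
    rw [hDw, inner_sub_left, inner_sub_left, inner_add_left, hT4, hT2, hΔP]
    linarith [hT1]
  rw [show ⟪A e, e⟫ = (-t₁) * ⟪fderiv ℝ w x₁ e, e⟫ by linarith [hE2']]
  exact mul_le_mul_of_nonneg_left hDw' ht

/-! ## The stub -/

/-- **stub_stretchRecordBudget** (line `oseen-shell-polar-tomography` of crux
`ExtremalBiaxialitySubcritical`) — the signed first-order budget at a stretching record: at a
space-time maximum `(t₁, x₁)` (value `M`) of the gauge stretching `(−t)⟪∇u(t,x)e, e⟫` in a fixed
unit direction `e` which is also Rayleigh-maximal at `(t₁, x₁)`, with `Λ_u(t₁,x₁) ≤ m`, and for any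
classical pressure `p` of `u` on a window `(t', 0) ∋ t₁`,
`⅓M² + M(1 − ⅔m) − ⅔m² ≤ −(−t₁)²⟪H e, e⟫ + ((−t₁)²|ω|² − ((−t₁)ω·e)²)/12 − ((−t₁)ω·e)²/6`.
Proof: `budget_core` (strain equation at the record, maximum principle, `Δp = −tr A²`), then at the
Rayleigh maximiser `⟪A²e,e⟫ = 2λ² − ‖Ae‖²`, `|ω|² − (ω·e)² = 4‖Ae‖² − 4λ²`
(`inner_add_inner_eq_of_rayleigh_max`, `norm_vort_sq_sub_eq`), the spectrum package
`tr A² = λ₁² + λ₂² + (λ₁+λ₂)² − ½|ω|²`, `λ₁ ≤ λ = M/(−t₁)`, `(−t₁)λ₂ = Λ ≤ m`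
(`strain_spectrum_package`), and `(M − L₁)(M + L₁ + Λ) ≥ 0`, `(m − Λ)(m + Λ + M) ≥ 0`.
[cite: MajdaBertozziCUP2002, §1.4 proof of Prop. 1.5 eq. (1.29) and §1.8 eq. (1.84)] -/
theorem stub_stretchRecordBudget :
    ∀ (C m : ℝ) (u : ℝ → EuclideanSpace ℝ (Fin 3) → EuclideanSpace ℝ (Fin 3)), IsTypeIAncientMild C u → ∀ (t₁ : ℝ), t₁ < 0 → ∀ (x₁ e : EuclideanSpace ℝ (Fin 3)), ‖e‖ = 1 → ∀ (M : ℝ), (-t₁) * inner ℝ (fderiv ℝ (u t₁) x₁ e) e = M → (∀ t < 0, ∀ x : EuclideanSpace ℝ (Fin 3), (-t) * inner ℝ (fderiv ℝ (u t) x e) e ≤ M) → (∀ e' : EuclideanSpace ℝ (Fin 3), ‖e'‖ = 1 → (-t₁) * inner ℝ (fderiv ℝ (u t₁) x₁ e') e' ≤ M) → lerayMiddleStrain u t₁ x₁ ≤ m → ∀ (t' : ℝ), t' < t₁ → ∀ (p : ℝ → EuclideanSpace ℝ (Fin 3) → ℝ), IsClassicalNSSolutionOn (Set.Ioo t' 0)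 1 0 u p → M ^ 2 / 3 + M * (1 - 2 * m / 3) - 2 * m ^ 2 / 3 ≤ -((-t₁) ^ 2 * inner ℝ (deviatoricHessian (p t₁) x₁ e) e) + ((-t₁) ^ 2 * ‖curl (u t₁) x₁‖ ^ 2 - ((-t₁) * inner ℝ (curl (u t₁) x₁) e) ^ 2) / 12 - ((-t₁) * inner ℝ (curl (u t₁) x₁) e) ^ 2 / 6 := by
  intro C m u _hu t₁ ht₁ x₁ e he M hM hmax hdir hmid t' ht' p hcl
  have ht : 0 < -t₁ := neg_pos.2 ht₁
  have hS : t₁ ∈ Set.Ioo t' 0 := ⟨ht', ht₁⟩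
  have hmax_t : IsLocalMax (fun s => (-s) * ⟪fderiv ℝ (u s) x₁ e, e⟫) t₁ := by
    filter_upwards [Iio_mem_nhds ht₁] with s hs
    show (-s) * ⟪fderiv ℝ (u s) x₁ e, e⟫ ≤ (-t₁) * ⟪fderiv ℝ (u t₁) x₁ e, e⟫
    rw [hM]
    exact hmax s hs x₁
  have hmax_x : IsLocalMax (fun y => ⟪fderiv ℝ (u t₁) y e, e⟫) x₁ := by
    refine Filter.Eventually.of_forall fun y => ?_
    have h := hmax t₁ ht₁ y
    rw [← hM] at h
    exact le_of_mul_le_mul_left h ht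
  have hcore := budget_core isOpen_Ioo hcl hS ht.le he hmax_t hmax_x
  have htrA : LinearMap.trace ℝ _ (fderiv ℝ (u t₁) x₁).toLinearMap = 0 := hcl.divFree t₁ hS x₁
  -- from here on only the gradient `A = ∇u(t₁, x₁)` matters
  rw [lerayMiddleStrain_def] at hmid
  rw [curl_eq_curlCLM]
  clear hmax_t hmax_x hcl hmax
  generalize fderiv ℝ (u t₁) x₁ = A at hM hdir hmid hcore htrA ⊢
  -- `e` maximises the Rayleigh quotient of `A`, with value `λ = ⟪Ae, e⟫ = M/(−t₁)`
  have h1 : ∀ x : EuclideanSpace ℝ (Fin 3), ⟪A x, x⟫ ≤ ⟪A e, e⟫ * ‖x‖ ^ 2 := by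
    intro x
    by_cases hx : x = 0
    · simp [hx]
    have hnx0 : ‖x‖ ≠ 0 := norm_ne_zero_iff.2 hx
    have hy : ‖‖x‖⁻¹ • x‖ = 1 := by
      rw [norm_smul, norm_inv, norm_norm, inv_mul_cancel₀ hnx0]
    have h' : ‖x‖⁻¹ * (‖x‖⁻¹ * ⟪A x, x⟫) ≤ ⟪A e, e⟫ := by
      have h := hdir (‖x‖⁻¹ • x) hy
      rw [map_smul, real_inner_smul_left, real_inner_smul_right, ← hM] at h
      exact le_of_mul_le_mul_left h ht
    calc ⟪A x, x⟫ = ‖x‖ ^ 2 * (‖x‖⁻¹ * (‖x‖⁻¹ * ⟪A x, x⟫)) := by field_simp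
      _ ≤ ‖x‖ ^ 2 * ⟪A e, e⟫ := mul_le_mul_of_nonneg_left h' (sq_nonneg _)
      _ = ⟪A e, e⟫ * ‖x‖ ^ 2 := mul_comm _ _
  have hc := inner_add_inner_eq_of_rayleigh_max A h1 (by rw [he, one_pow, mul_one])
  have hAAe : ⟪A (A e), e⟫ = 2 * ⟪A e, e⟫ ^ 2 - ‖A e‖ ^ 2 := by
    have h := hc (A e)
    rw [real_inner_self_eq_norm_sq, real_inner_comm (A e) e] at h
    linear_combination h
  have hvort := norm_vort_sq_sub_eq A hc he rfl
  -- the strain spectrum of the trace-free `A`, in the gauge `L₀ = (−t₁)λ₁ ≤ M`, `Λ = (−t₁)λ₂ ≤ m`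
  obtain ⟨s0, s1, hs1, h10, h21, htrAA, hl0⟩ := strain_spectrum_package A htrA
  rw [← hs1] at hmid
  have hL0 : (-t₁) * s0 ≤ M := by
    rw [← hM]
    exact mul_le_mul_of_nonneg_left (hl0 _ h1) ht.le
  have hq0 : 0 ≤ (-t₁) * (2 * s0 + s1) := mul_nonneg ht.le (by linarith)
  have hq1 : 0 ≤ (-t₁) * (s0 + 2 * s1) := mul_nonneg ht.le (by linarith)
  have p1 : 0 ≤ (M - (-t₁) * s0) * (M + (-t₁) * s0 + (-t₁) * s1) :=
    mul_nonneg (by linarith) (by linarith)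
  have p2 : 0 ≤ (m - (-t₁) * s1) * (m + (-t₁) * s1 + M) := mul_nonneg (by linarith) (by linarith)
  have hc2 := mul_le_mul_of_nonneg_left hcore ht.le
  rw [hM] at hc2
  nlinarith [hc2, hAAe, hvort, htrAA, p1, p2, hM, ht]

end Summit.NavierStokesRegularity.NavierStokesRegularity.Theorems

end
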